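import Summits.KontsevichZagierPeriods.KontsevichZagierPeriods.Theses.MellinCoarea
import Literature.NumberTheory.Transcendental.KZProduct
import Literature.NumberTheory.Transcendental.KZKernelConjectureForms

/-!
# `SummitImpliesTransfer` (stmt-KontsevichZagierPeriods-10575, route MellinCoarea) — proof

Honesty item of route MellinCoarea: the summit `KontsevichZagierPeriods` implies the route's
target `FibrewiseTransfer` (Conjecture 1 in families: a.e.-equality in the base point `x ∈ ℝᵇ` of
the fibre integrals `∫_{y : (x,y) ∈ σ} f (x,y) dy` of two representations of dimension `b + k`
implies their KZ-equivalence), certifying that the target is a reformulation of Conjecture 1 and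
not a strengthening. Proof: the value of a representation is the integral over the base of its
fibre integrals — Fubini along the volume-preserving equivalence `Fin.append : ℝᵇ × ℝᵏ ≃ ℝᵇ⁺ᵏ`
(`KZ.appendMeasurableEquiv`, `KZ.volume_preserving_appendMeasurableEquiv` of
`Literature/NumberTheory/Transcendental/KZProduct.lean`) applied to the zero-extended integrand —
so a.e.-equal fibre integrals give equal values; the summit, in its `ℚ`-semialgebraic
two-representation form (`kzPeriodConjecture'_iff_isRational`, proved in tree: pass to KZ-rational
equivalents and compose), then makes the two representations KZ-equivalent. Planner-described
glue, landed by lead c10 of crux stmt-KontsevichZagierPeriods-9129 (banking). No definitions.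
-/

namespace Summit.KontsevichZagierPeriods.MellinCoarea

open MeasureTheory
open Summit.KontsevichZagierPeriods.KontsevichZagierPeriods.Theses.MellinCoarea
open Literature.NumberTheory.Transcendental

/-- **Fubini along `Fin.append`.** The value of an integral representation of dimension `b + k`
is the integral over the base `ℝᵇ` of its fibre integrals
`x ↦ ∫_{y | append x y ∈ σ} f (append x y) dy` (zero-extend the integrand, transport along the
volume-preserving `KZ.appendMeasurableEquiv`, apply `MeasureTheory.integral_prod`, and read each
inner integral of the zero extension as the set integral over the measurable fibre). [folklore] -/
theorem value_eq_integral_fibreIntegral {b k : ℕ} (r : KZ.IntegralRep (b + k)) :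
    r.value = ∫ x : Fin b → ℝ, ∫ y in {y : Fin k → ℝ | Fin.append x y ∈ r.domain},
      r.integrand (Fin.append x y) := by
  have hmeas : MeasurableSet r.domain := KZ.IntegralRep.measurableSet_domain_holds r
  -- the zero-extended integrand is integrable on the whole space
  have hFint : Integrable (r.domain.indicator r.integrand) (volume : Measure (Fin (b + k) → ℝ)) :=
    r.integrableOn.integrable_indicator hmeas
  have h1 : r.value = ∫ z, r.domain.indicator r.integrand z := (integral_indicator hmeas).symm
  -- transport along the volume-preserving `Fin.append`
  have h2 : ∫ z, r.domain.indicator r.integrand z =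
      ∫ p : (Fin b → ℝ) × (Fin k → ℝ), r.domain.indicator r.integrand (Fin.append p.1 p.2) := by
    rw [← (KZ.volume_preserving_appendMeasurableEquiv (n := b) (m := k)).integral_comp'
      (r.domain.indicator r.integrand)]
    simp only [KZ.appendMeasurableEquiv_apply]
  have hGint : Integrable
      (fun p : (Fin b → ℝ) × (Fin k → ℝ) => r.domain.indicator r.integrand (Fin.append p.1 p.2))
      ((volume : Measure (Fin b → ℝ)).prod (volume : Measure (Fin k → ℝ))) := by
    have h := ((KZ.volume_preserving_appendMeasurableEquiv (n := b) (m := k)).integrable_comp_emb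
      (KZ.appendMeasurableEquiv b k).measurableEmbedding).mpr hFint
    rw [← Measure.volume_eq_prod]
    refine h.congr (Filter.Eventually.of_forall fun p => ?_)
    simp only [Function.comp_apply, KZ.appendMeasurableEquiv_apply]
  -- Fubini
  have h3 : ∫ p : (Fin b → ℝ) × (Fin k → ℝ), r.domain.indicator r.integrand (Fin.append p.1 p.2) =
      ∫ x : Fin b → ℝ, ∫ y : Fin k → ℝ, r.domain.indicator r.integrand (Fin.append x y) := by
    rw [Measure.volume_eq_prod, integral_prod _ hGint]
  -- each inner integral of the zero extension is the fibre set integral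
  have h4 : ∀ x : Fin b → ℝ, ∫ y : Fin k → ℝ, r.domain.indicator r.integrand (Fin.append x y) =
      ∫ y in {y : Fin k → ℝ | Fin.append x y ∈ r.domain}, r.integrand (Fin.append x y) := by
    intro x
    have hmx : Measurable (fun y : Fin k → ℝ => Fin.append x y) := by
      have : (fun y : Fin k → ℝ => Fin.append x y) = (KZ.appendMeasurableEquiv b k) ∘ (Prod.mk x) := by
        funext y
        simp only [Function.comp_apply, KZ.appendMeasurableEquiv_apply]
      rw [this]
      exact (KZ.appendMeasurableEquiv b k).measurable.comp measurable_prodMk_left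
    have hfun : (fun y : Fin k → ℝ => r.domain.indicator r.integrand (Fin.append x y)) =
        {y : Fin k → ℝ | Fin.append x y ∈ r.domain}.indicator
          (fun y => r.integrand (Fin.append x y)) := by
      funext y
      exact (Set.indicator_comp_right (fun y : Fin k → ℝ => Fin.append x y)).symm
    rw [hfun]
    exact integral_indicator (hmx hmeas : MeasurableSet {y : Fin k → ℝ | Fin.append x y ∈ r.domain})
  rw [h1, h2, h3]
  exact integral_congr_ae (Filter.Eventually.of_forall h4)

/-- **`SummitImpliesTransfer`** (route MellinCoarea, stmt-KontsevichZagierPeriods-10575): the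
summit `KontsevichZagierPeriods` implies `FibrewiseTransfer`. Proof: by
`value_eq_integral_fibreIntegral` (Fubini along `Fin.append`) a.e.-equality of the fibre
integrals gives `r.value = r'.value` (`MeasureTheory.integral_congr_ae`); the summit unfolds
(`KontsevichZagierPeriods_iff`) to the right-hand side of `kzPeriodConjecture'_iff_isRational`,
whose left-hand side `KZPeriodConjecture'` turns equal values into `KZ.Equivalent r r'`.
[folklore] -/
theorem summitImpliesTransfer_proof :
    Summit.KontsevichZagierPeriods.KontsevichZagierPeriods.Theses.MellinCoarea.SummitImpliesTransfer := by
  intro h b k r r' hae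
  have hv : r.value = r'.value := by
    rw [value_eq_integral_fibreIntegral r, value_eq_integral_fibreIntegral r']
    exact integral_congr_ae hae
  exact kzPeriodConjecture'_iff_isRational.mpr (KontsevichZagierPeriods_iff.mp h) r r' hv

end Summit.KontsevichZagierPeriods.MellinCoarea
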